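import Summits.CriticalPhenomena.Ising3D.Control2DBoxCells
import Summits.CriticalPhenomena.Ising3D.Control2DOpeTwoSided
import Summits.CriticalPhenomena.Ising3D.Control2DTaylorSound
import Summits.CriticalPhenomena.Ising3D.Control2DRegionKernel
import Summits.CriticalPhenomena.Ising3D.Control2DKernelCell
import Mathlib.Tactic.Linarith
import Mathlib.Tactic.Positivity
import Mathlib.Tactic.FieldSimp
import Mathlib.Tactic.LinearCombination
import HarnessLib

/-!
# Kind `ope2`, sense upper, from kernel-checkable data: the cells record + (I′) and the `T` value on a truncated block
(cell `pub-ising3x`, seat controls-1 gen 20; KERNEL PATH for the 2D γ-certificates, kind `ope2` — CONTROL-ONLY)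

HONEST FRAMING: lottery ticket; floor = tightest certified 3D Ising CFT bounds; no exact-solution
claim without a proof. CONTROL-ONLY (`d = 2`, axiom set `A2D′`); nothing numerical is asserted here.

`Control2DOpeTwoSided` (controls-1 g12) typed the lane's `c` datum: `OpeUpperA2D s G δ e₁ e₂ P` (`p_T < P` ⇒
`c > Δ_σ²/(2P)`) follows from the obligations record `OpeA2DObligations φ …` of a functional `φ` plus the SIGN
`φ[F_-[g_{2,2}]] > 0` (`opeUpper`, `opeUpper_taylor`); the reader-certified RB-6 rungs enter `cTwoSided_rb6_L11/L15/L19`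
as HYPOTHESES. This file is the kernel-path bridge for the UPPER sense, in the shape the box-kind replays already
produce: for the table functional `φ = taylorFunctional2D (1/2) S w` it derives `OpeUpperA2D` from
* the box-kind cells record `BoxCellsN S w s G δ e₁ e₂ E₀` (truncated blocks, per-cell witnesses `N ≥ E₀` — exactly what a
  kernel replay of the cell polynomials proves, `Control2DL19Box*`),
* the region inequality (R) (hypothesis `hR`, as decided by `region_of_kernelCertAuto`),
* (I′) on the TRUNCATED stress-tensor block: `0 < φ[F_-[1]] + P · φ[F_-[Q_{N_T}(2,2)]]` with `P ≥ 0`, and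
* the `T` value on the truncated block: `0 < φ[F_-[Q_{N_T}(2,2)]]`, `N_T + 2 ≥ E₀`.
The two truncated statements imply the full ones because a Taylor functional with the above-threshold pair
positivity UNDER-estimates every block by its truncation (`phi_QN_le_block_taylor`: the dropped z-series terms are
non-negative pairs). The LOWER sense (`φ[F_-[g_{2,2}]] < 0`) needs an explicit tail MAJORANT and is not covered here.
Second part (the shape a kernel replay instantiates, `Δ_σ = 1/8`): `opeUpper_half_of_cellsZ` takes (I′) and the `T` value as
INTEGER inequalities on the kernel's own objects — `identZ wt Sl Λ` ((I), `Control2DRegionKernel`), the constant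
coefficient of the spin-2 cell polynomial `cellPolyZ wt Sl Λ 2 Nd` at `y = (Δ-ℓ)/2 = 0` (= its head, the `T` point) and
the natural number `denProdNat` (= `denProd … 0`, the normalisation `cellConst` at `Δ = ℓ = 2`) — using the exact
identities `regConst · φ[F_-[1]] = (1/2)^{1/8}(1/2)^{1/8} · identZ` and `P̂₂(0) = cellConst · φ[F_-[Q_{Nd+1}(2,2)]]`; the
irrational factor `(1/2)^{1/4}` is common to both terms and drops out of the sign.
PROVED; no facts, standard axioms only. [cite: RattazziEtAl2008, §5]
-/

namespace Summit.CriticalPhenomena.Ising3D.Control2D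

open Finset Set
open Literature.Analysis.ValidatedNumerics.PolyMP
open Literature.MathematicalPhysics.QuantumFieldTheory.ConformalBootstrap3D

/-- **Kind `ope2`, sense upper, at `(1/2,1/2)` from the cells record** (`s < 1`, `2s < e₁`, `2s < G`, `e₁, G, δ ≥ 0`,
`P ≥ 0`): (I′) and the `T` sign checked on the truncated `(2,2)` block `Q_{N_T}` (`N_T + 2 ≥ E₀`), the region
inequality (R) and the box-kind cells record give `OpeUpperA2D s G δ e₁ e₂ P` (`p_T < P`). PROVED
(`phi_QN_le_block_taylor` lifts both truncated statements; cells as in `boxObligations_half_of_explicitN`;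
then `OpeA2DObligations.opeUpper_taylor`). [cite: RattazziEtAl2008, §5] -/
theorem opeUpper_half_of_cellsN (S : Finset (ℕ × ℕ)) (w : ℕ × ℕ → ℝ) {s G δ e₁ e₂ P E₀ : ℝ} {NT : ℕ}
    (hs1 : s < 1) (he : 2 * s < e₁) (hG : 2 * s < G) (he₁ : 0 ≤ e₁) (hG0 : 0 ≤ G) (hδ : 0 ≤ δ)
    (hP : 0 ≤ P) (hNT : E₀ ≤ 2 + NT)
    (hI' : 0 < taylorFunctional2D (1 / 2) S w (crossF s (-1) (fun _ _ => (1 : ℝ))) +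
      P * taylorFunctional2D (1 / 2) S w (crossF s (-1) (QN NT 2 2)))
    (hT : 0 < taylorFunctional2D (1 / 2) S w (crossF s (-1) (QN NT 2 2)))
    (hR : ∀ (b : ℝ) (J : ℕ), 0 ≤ b → E₀ ≤ 2 * b + J →
      0 ≤ ∑ p ∈ S, w p * ((1 - (-1 : ℝ) ^ (p.1 + p.2)) * 2 ^ (p.1 + p.2) *
        (qFactor₁ s (b + J) p.1 * qFactor₁ s b p.2 + qFactor₁ s b p.1 * qFactor₁ s (b + J) p.2)))
    (hc : BoxCellsN S w s G δ e₁ e₂ E₀) : OpeUpperA2D s G δ e₁ e₂ P := by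
  have hφ := isTaylorFunctional_taylorFunctional2D (1 / 2) S w
  have hx0 : (0 : ℝ) < 1 / 2 := by norm_num
  have hx1 : (1 / 2 : ℝ) < 1 := by norm_num
  have hpair : PairPositiveAbove (taylorFunctional2D (1 / 2) S w) s E₀ :=
    pairPositiveAbove_half_of_poly S w hR
  -- cells below `E₀` by truncation at their witnesses; points at or above `E₀` directly by (R)
  have hcell : ∀ (ℓ : ℕ) (Δ : ℝ), (ℓ : ℝ) ≤ Δ →
      (∃ N : ℕ, E₀ ≤ N ∧ 0 ≤ taylorFunctional2D (1 / 2) S w (crossF s (-1) (QN N ℓ Δ))) →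
      BlockPositive (taylorFunctional2D (1 / 2) S w) s Δ ℓ := by
    intro ℓ Δ hℓΔ hQ
    rcases le_or_gt E₀ Δ with hge | hlt
    · exact high_nonneg_of_pairPositive_taylor hφ hx0 hx1 hpair ℓ Δ hℓΔ hge
    · obtain ⟨N, hN, h⟩ := hQ
      have : (0 : ℝ) ≤ ℓ := Nat.cast_nonneg ℓ
      exact blockPositive_of_QN_nonneg_taylor hφ hx0 hx1 hpair (N := N) hℓΔ (by linarith) h
  -- the truncated `(2,2)` block under-estimates the full one
  have hTle : taylorFunctional2D (1 / 2) S w (crossF s (-1) (QN NT 2 2)) ≤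
      taylorFunctional2D (1 / 2) S w (crossF s (-1) (globalBlock 2 2)) :=
    phi_QN_le_block_taylor hφ hx0 hx1 hpair (Δ := 2) (ℓ := 2) (N := NT) (by norm_num) (by linarith)
  have hX : 0 < taylorFunctional2D (1 / 2) S w (crossF s (-1) (globalBlock 2 2)) := lt_of_lt_of_le hT hTle
  have hob : OpeA2DObligations (taylorFunctional2D (1 / 2) S w) s G δ e₁ e₂ P E₀ := by
    refine ⟨?_, ?_, ?_, ?_, ?_, ?_⟩
    · have hmul : P * taylorFunctional2D (1 / 2) S w (crossF s (-1) (QN NT 2 2)) ≤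
          P * taylorFunctional2D (1 / 2) S w (crossF s (-1) (globalBlock 2 2)) :=
        mul_le_mul_of_nonneg_left hTle hP
      linarith
    · intro Δ h1 h2
      exact hcell 0 Δ (by simp only [Nat.cast_zero]; linarith) (hc.1 Δ h1 h2)
    · intro Δ h1 h2
      exact hcell 0 Δ (by simp only [Nat.cast_zero]; linarith) (hc.2.1 Δ h1 h2)
    · intro Δ h1 h2
      exact hcell 2 Δ (by push_cast; linarith) (hc.2.2.2.1 Δ h1 h2)
    · intro ℓ hℓ hℓ0 hℓ2 Δ hℓΔ hΔE
      exact hcell ℓ Δ hℓΔ (hc.2.2.2.2 ℓ hℓ hℓ0 hℓ2 Δ hℓΔ hΔE)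
    · exact fun ℓ _ Δ hℓΔ hge => high_nonneg_of_pairPositive_taylor hφ hx0 hx1 hpair ℓ Δ hℓΔ hge
  exact OpeA2DObligations.opeUpper_taylor hφ hx0 hx1 he hG hs1 hob hX

/-! ### The integer form a kernel replay instantiates (`Δ_σ = 1/8`) -/

/-- The product of the chiral-factor denominators at `y = 0` as a natural number: `denProd Nd c 0 = denProdNat Nd c`
(`2` for `i = 0`, `(i+1)(2c+i)` for `i ≥ 1`). [folklore] -/
def denProdNat (Nd c : ℕ) : ℕ := ∏ i ∈ range Nd, (if i = 0 then 2 else (i + 1) * (2 * c + i))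

/-- [folklore] -/
theorem denProd_zero (Nd c : ℕ) : denProd Nd c 0 = (denProdNat Nd c : ℝ) := by
  unfold denProd denProdNat
  rw [Nat.cast_prod]
  refine Finset.prod_congr rfl fun i _ => ?_
  rw [evalR_denZ]
  split_ifs <;> push_cast <;> ring

/-- Evaluating an integer coefficient list at `0` returns its head. [folklore] -/
theorem evalR_castZ_zero (l : List ℤ) : evalR (castZ l) 0 = ((l.headD 0 : ℤ) : ℝ) := by
  cases l with
  | nil => simp
  | cons a as => simp

/-- **Kind `ope2`, sense upper, from KERNEL data** (`Δ_σ = 1/8`, bound `P = Pn/Pd`): (I′) as the integer inequality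
`0 < Pd · identZ · 4^{Nd+1} · denProdNat Nd 2 · denProdNat Nd 0 + Pn · P̂₂(0)` and the `T` value as `0 < P̂₂(0)`, where
`P̂₂(0) = (cellPolyZ wt Sl Λ 2 Nd).headD 0` is the constant coefficient of the spin-2 cell polynomial (both decidable on
the literals a replay materialises), plus (R) and the box-kind cells record, give `OpeUpperA2D (1/8) G δ e₁ e₂ (Pn/Pd)`.
PROVED (exact normalisations `regConst_mul_taylorFunctional2D_one`, `evalR_cellPolyZ`; then `opeUpper_half_of_cellsN`).
[cite: RattazziEtAl2008, §5] -/
theorem opeUpper_half_of_cellsZ (wt : ℕ × ℕ → ℤ) {Sl : List (ℕ × ℕ)} (hnd : Sl.Nodup) {Λ : ℕ}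
    (hΛ : ∀ p ∈ Sl, p.1 + p.2 ≤ Λ) {G δ e₁ e₂ E₀ : ℝ} {Pn Pd Nd : ℕ}
    (he : 1 / 4 < e₁) (hG : 1 / 4 < G) (hG0 : 0 ≤ G) (hδ : 0 ≤ δ) (hPd : 0 < Pd)
    (hNd : E₀ ≤ 2 + ((Nd + 1 : ℕ) : ℝ))
    (hIT : 0 < (Pd : ℤ) * (identZ wt Sl Λ * (4 ^ (Nd + 1) * ((denProdNat Nd 2 * denProdNat Nd 0 : ℕ) : ℤ))) +
      (Pn : ℤ) * (cellPolyZ wt Sl Λ 2 Nd).headD 0)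
    (hT : 0 < (cellPolyZ wt Sl Λ 2 Nd).headD 0)
    (hR : ∀ (b : ℝ) (J : ℕ), 0 ≤ b → E₀ ≤ 2 * b + J →
      0 ≤ ∑ p ∈ Sl.toFinset, (wt p : ℝ) * ((1 - (-1 : ℝ) ^ (p.1 + p.2)) * 2 ^ (p.1 + p.2) *
        (qFactor₁ (1 / 8) (b + J) p.1 * qFactor₁ (1 / 8) b p.2 +
          qFactor₁ (1 / 8) b p.1 * qFactor₁ (1 / 8) (b + J) p.2)))
    (hc : BoxCellsN Sl.toFinset (fun p => (wt p : ℝ)) (1 / 8) G δ e₁ e₂ E₀) :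
    OpeUpperA2D (1 / 8) G δ e₁ e₂ ((Pn : ℝ) / Pd) := by
  set φ1 := taylorFunctional2D (1 / 2) Sl.toFinset (fun p => (wt p : ℝ))
    (crossF (1 / 8) (-1) (fun _ _ => (1 : ℝ))) with hφ1
  set φT := taylorFunctional2D (1 / 2) Sl.toFinset (fun p => (wt p : ℝ))
    (crossF (1 / 8) (-1) (QN (Nd + 1) 2 2)) with hφT
  set c2 : ℝ := (1 / 2 : ℝ) ^ (1 / 8 : ℝ) * (1 / 2 : ℝ) ^ (1 / 8 : ℝ) with hc2
  have hc2pos : 0 < c2 := by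
    have h3 : (0 : ℝ) < (1 / 2 : ℝ) ^ (1 / 8 : ℝ) := Real.rpow_pos_of_pos (by norm_num) _
    rw [hc2]; positivity
  have hK := regConst_pos Λ
  have hPdR : (0 : ℝ) < Pd := by exact_mod_cast hPd
  have hD2 : (0 : ℝ) < denProdNat Nd 2 := by rw [← denProd_zero]; exact denProd_pos Nd 2 (by norm_num)
  have hD0 : (0 : ℝ) < denProdNat Nd 0 := by rw [← denProd_zero]; exact denProd_pos Nd 0 (by norm_num)
  -- (I): `regConst · φ1 = c2 · identZ`
  have h1 : regConst Λ * φ1 = c2 * (identZ wt Sl Λ : ℝ) := regConst_mul_taylorFunctional2D_one wt hnd hΛ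
  -- the `T` point: `P̂₂(0) = cellConst · φT`, `cellConst = regConst · 4^Nd · D₂ · D₀ / (c2/4)`
  have h2 := evalR_cellPolyZ wt hnd hΛ 2 Nd (Δ := (2 : ℝ)) (by norm_num)
  have h0 : ((2 : ℝ) - ((2 : ℕ) : ℝ)) / 2 = 0 := by norm_num
  rw [h0, evalR_castZ_zero] at h2
  have hcc : cellConst Λ 2 Nd 2 = regConst Λ * 4 ^ Nd * (denProdNat Nd 2 : ℝ) * (denProdNat Nd 0 : ℝ) *
      (c2 * (1 / 4))⁻¹ := by
    rw [hc2]
    unfold cellConst regConst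
    rw [h0, denProd_zero, denProd_zero, Real.rpow_two, show ((1 : ℝ) / 2) ^ 2 = 1 / 4 by norm_num]
  have hTpos : 0 < φT := by
    have hhead : (0 : ℝ) < (((cellPolyZ wt Sl Λ 2 Nd).headD 0 : ℤ) : ℝ) := by exact_mod_cast hT
    rw [h2] at hhead
    exact (mul_pos_iff_of_pos_left (cellConst_pos Λ 2 Nd (by norm_num))).mp hhead
  -- `regConst · 4^{Nd+1} · D₂ · D₀ · φT = c2 · P̂₂(0)`
  have h2' : regConst Λ * 4 ^ (Nd + 1) * (denProdNat Nd 2 : ℝ) * (denProdNat Nd 0 : ℝ) * φT =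
      c2 * (((cellPolyZ wt Sl Λ 2 Nd).headD 0 : ℤ) : ℝ) := by
    rw [h2, hcc]
    field_simp
    ring
  have hITR : (0 : ℝ) < (Pd : ℝ) * ((identZ wt Sl Λ : ℝ) * (4 ^ (Nd + 1) *
      ((denProdNat Nd 2 : ℝ) * (denProdNat Nd 0 : ℝ)))) + (Pn : ℝ) * (((cellPolyZ wt Sl Λ 2 Nd).headD 0 : ℤ) : ℝ) := by
    exact_mod_cast hIT
  have hI' : 0 < φ1 + ((Pn : ℝ) / Pd) * φT := by
    -- positive multiple of the integer combination
    have key : regConst Λ * (Pd : ℝ) * 4 ^ (Nd + 1) * (denProdNat Nd 2 : ℝ) * (denProdNat Nd 0 : ℝ) *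
        (φ1 + ((Pn : ℝ) / Pd) * φT) =
        c2 * ((Pd : ℝ) * ((identZ wt Sl Λ : ℝ) * (4 ^ (Nd + 1) * ((denProdNat Nd 2 : ℝ) * (denProdNat Nd 0 : ℝ)))) +
          (Pn : ℝ) * (((cellPolyZ wt Sl Λ 2 Nd).headD 0 : ℤ) : ℝ)) := by
      have hPd0 : (Pd : ℝ) ≠ 0 := ne_of_gt hPdR
      field_simp
      linear_combination ((Pd : ℝ) * 4 ^ (Nd + 1) * (denProdNat Nd 2 : ℝ) * (denProdNat Nd 0 : ℝ)) * h1 +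
        (Pn : ℝ) * h2'
    have hM : 0 < regConst Λ * (Pd : ℝ) * 4 ^ (Nd + 1) * (denProdNat Nd 2 : ℝ) * (denProdNat Nd 0 : ℝ) := by positivity
    have := mul_pos hc2pos hITR
    rw [← key] at this
    exact (mul_pos_iff_of_pos_left hM).mp this
  exact opeUpper_half_of_cellsN Sl.toFinset (fun p => (wt p : ℝ)) (by norm_num) (by linarith) (by linarith)
    (by linarith) hG0 hδ (by positivity) hNd hI' hTpos hR hc

end Summit.CriticalPhenomena.Ising3D.Control2D
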